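import Summits.CriticalPhenomena.Ising3DConformalLimit.Theses.MonotoneBlocking
import Literature.Probability.LatticeModels.HighDimPointwiseTriviality
import Literature.Probability.LatticeModels.ImprovedTreeDiagramBoundProofs
import Summits.CriticalPhenomena.Ising3DConformalLimit.Theorems.MoebiusLimitExists.Negative.LocalBoundsDoubling
import HarnessLib

/-!
# `NonSeparableModulus` (stmt-CriticalPhenomena-6152): the mesh threshold cannot precede the compact set

Negative knowledge about the crux `…Theses.MonotoneBlocking.NonSeparableModulus` (NS), standing crux
disprover (D-0016); THEOREM-ONLY (no definitions), supports the item, closes nothing. Split of §3 of the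
work file `Summits/CriticalPhenomena/Ising3DConformalLimit/Cruxes/NonSeparableModulus/Disproof.lean`;
companion of `Negative/LatticeCoincidence.lean` (`NonCoincident` and compactness are load-bearing).

* `nonSeparableModulus_false_uniformMesh` — the strengthening `∃ δ₀ ∀ K` of NS (mesh threshold chosen
  BEFORE the compact set, everything else verbatim; in particular "all `δ ∈ (0,1)`") is FALSE.
  Witness: the caged wall-crossing family `s ↦ (δ₁ − s, δ₁/4, 3δ₁/2, 7δ₁/4)·e₀`, `s ∈ [0, δ₁/2]` (four
  axial points; point `0` lies strictly between points `1` and `2`, hence is never `m`-separable, by any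
  vector) at the admissible mesh `δ₁ = min δ₀ 1 / 2 < δ₀`: for `s > 0` its lattice shadow is
  `(0,0,1,1)·e₀` (pinned zoom `ρ★⁴`, `σ² = 1`) while the move `x₀ ↦ δ₁e₀` of length `s → 0` gives
  `(1,0,1,1)·e₀` (pinned zoom `ρ★⁴ g(1)`): a jump `ρ★(δ₁)⁴ (1 − g 1) > 0` beating every `η`.
* `criticalTwoPoint_e0_lt_one : ⟨σ₀σ_{e₀}⟩_{β_c(3)} < 1` — if it were `1`, the GKS pair inequality
  `g(k) g(1) ≤ g(k+1)` (`twoPointPlus_mul_le_twoPointPlus`) would force `g ≡ 1`, against the infrared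
  decay `g(k) ≤ C/k` (`criticalTwoPoint_bounds_holds`).

Moral for provers: in NS the order `∀ K ∃ δ₀` is essential (`δ₀ ≪ sep K`); no modulus survives at
meshes comparable to the configuration scale — a pure lattice artefact, not a property of the limit.
References: Friedli–Velenik 2017 Thm 3.20 (GKS) [FriedliVelenik2017]; Duminil-Copin 2019 Thm 4.8
[DuminilCopin2019].
-/

noncomputable section

namespace Summit.CriticalPhenomena.Ising3DConformalLimit.NonSeparableModulusNegative

open Literature.Probability.LatticeModels
open Summit.CriticalPhenomena.Ising3DConformalLimit.Theses
open Summit.CriticalPhenomena.Ising3DConformalLimit.MoebiusLimitExistsNegative (latticeApprox_single_zero)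

/-! ## Four-point values with coincidences (`σ² = 1`) and `g(1) < 1` -/

/-- `σ_a² = 1` pointwise. [cite: FriedliVelenik2017, §3.6.1] -/
theorem spinAt_mul_self_site (a : Site 3) (s : SpinConfig (Site 3)) : spinAt a s * spinAt a s = 1 := by
  unfold spinAt
  rw [← Int.cast_mul, ← Units.val_mul, Int.units_mul_self]
  simp

/-- `⟨σ_a σ_a σ_b σ_b⟩_{β_c} = 1`. [folklore] -/
theorem criticalCorr_four_aabb (a b : Site 3) : criticalCorr 3 4 ![a, a, b, b] = 1 := by
  have h : criticalCorr 3 4 ![a, a, b, b] = criticalCorr 3 2 ![b, b] := by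
    show plusExpect 3 (criticalBeta 3) 0 (spinMonomial ![a, a, b, b]) =
      plusExpect 3 (criticalBeta 3) 0 (spinMonomial ![b, b])
    congr 1
    funext s
    simp only [spinMonomial, Fin.prod_univ_four, Fin.prod_univ_two, Matrix.cons_val_zero,
      Matrix.cons_val_one, Matrix.cons_val]
    rw [spinAt_mul_self_site, one_mul]
  rw [h, criticalCorr_two_pair, sub_self, criticalTwoPoint_zero']

/-- `⟨σ_b σ_a σ_b σ_b⟩_{β_c} = ⟨σ₀ σ_{b−a}⟩_{β_c}`. [folklore] -/
theorem criticalCorr_four_babb (a b : Site 3) :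
    criticalCorr 3 4 ![b, a, b, b] = criticalTwoPoint 3 (b - a) := by
  have h : criticalCorr 3 4 ![b, a, b, b] = criticalCorr 3 2 ![a, b] := by
    show plusExpect 3 (criticalBeta 3) 0 (spinMonomial ![b, a, b, b]) =
      plusExpect 3 (criticalBeta 3) 0 (spinMonomial ![a, b])
    congr 1
    funext s
    simp only [spinMonomial, Fin.prod_univ_four, Fin.prod_univ_two, Matrix.cons_val_zero,
      Matrix.cons_val_one, Matrix.cons_val]
    calc spinAt b s * spinAt a s * spinAt b s * spinAt b s
        = spinAt a s * spinAt b s * (spinAt b s * spinAt b s) := by ring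
      _ = spinAt a s * spinAt b s := by rw [spinAt_mul_self_site, mul_one]
  rw [h, criticalCorr_two_pair]

/-- GKS II along the axis: `g(k) · g(1) ≤ g(k+1)`, `g(k) = ⟨σ₀σ_{ke₀}⟩_{β_c}`.
[cite: FriedliVelenik2017, Thm. 3.20] -/
theorem criticalTwoPoint_axis_mul_e0_le (k : ℤ) :
    criticalTwoPoint 3 (Pi.single 0 k) * criticalTwoPoint 3 (Pi.single 0 1) ≤
      criticalTwoPoint 3 (Pi.single 0 (k + 1)) := by
  have h := twoPointPlus_mul_le_twoPointPlus (d := 3) (criticalBeta_nonneg 3)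
    (Pi.single 0 k) (Pi.single 0 (k + 1))
  rw [← Pi.single_sub, show k + 1 - k = 1 by ring] at h
  exact h

/-- **Nearest neighbours are not perfectly correlated at `β_c(3)`**: `⟨σ₀σ_{e₀}⟩_{β_c} < 1`.
[folklore] -/
theorem criticalTwoPoint_e0_lt_one : criticalTwoPoint 3 (Pi.single 0 1) < 1 := by
  by_contra hge
  push Not at hge
  have h1 : criticalTwoPoint 3 (Pi.single 0 1) = 1 := le_antisymm (criticalTwoPoint_le_one' _) hge
  have hall : ∀ k : ℕ, criticalTwoPoint 3 (Pi.single 0 (k : ℤ)) = 1 := by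
    intro k
    induction k with
    | zero => simp [criticalTwoPoint_zero']
    | succ k ih =>
      refine le_antisymm (criticalTwoPoint_le_one' _) ?_
      have := criticalTwoPoint_axis_mul_e0_le k
      rw [ih, h1, one_mul] at this
      push_cast
      exact this
  obtain ⟨c, C, -, hb⟩ := criticalTwoPoint_bounds_holds (d := 3) le_rfl
  set k : ℕ := ⌈C⌉₊ + 2 with hk
  have hx : (Pi.single 0 (k : ℤ) : Site 3) ≠ 0 := by
    intro h0; have := congr_fun h0 0; simp [hk] at this; omega
  have h2 := (hb _ hx).2
  have hnorm : ‖(Pi.single 0 (k : ℤ) : Site 3)‖ = (k : ℝ) := by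
    rw [Pi.norm_single, Int.norm_eq_abs]; push_cast; exact abs_of_nonneg (by positivity)
  rw [hall, hnorm, show (-(((3:ℕ) : ℝ) - 2)) = (-1 : ℝ) by norm_num, Real.rpow_neg_one] at h2
  have hkpos : (0 : ℝ) < k := by rw [hk]; positivity
  have hkC : C + 1 ≤ k := by
    rw [hk]; push_cast; linarith [Nat.le_ceil C]
  have : C * (k : ℝ)⁻¹ < 1 := by
    rw [← div_eq_mul_inv, div_lt_one hkpos]; linarith
  linarith

/-! ## The caged wall-crossing family -/

/-- Axial configurations inherit injectivity from their coefficients. [folklore] -/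
theorem injective_axial {n : ℕ} {t : Fin n → ℝ} (ht : Function.Injective t) :
    Function.Injective fun i => (EuclideanSpace.single (0 : Fin 3) (t i) : EuclideanSpace ℝ (Fin 3)) := by
  intro i j h
  have h' := congrArg (fun v : EuclideanSpace ℝ (Fin 3) => v 0) h
  simp only [PiLp.single_apply, if_true] at h'
  exact ht h'

/-- On an axial configuration a point lying strictly between two others is caged: it is neither
`m`-ahead nor `m`-behind all other points along ANY vector `u` (`m > 0`). [folklore] -/
theorem not_caged_disjunction_axial {t : Fin 4 → ℝ} (h1 : t 1 < t 0) (h2 : t 0 < t 2) {m : ℝ}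
    (hm : 0 < m) (u : EuclideanSpace ℝ (Fin 3)) :
    ¬ ((∀ j : Fin 4, j ≠ 0 →
          inner ℝ u (EuclideanSpace.single (0 : Fin 3) (t j) : EuclideanSpace ℝ (Fin 3)) + m ≤
            inner ℝ u (EuclideanSpace.single (0 : Fin 3) (t 0) : EuclideanSpace ℝ (Fin 3))) ∨
       (∀ j : Fin 4, j ≠ 0 →
          inner ℝ u (EuclideanSpace.single (0 : Fin 3) (t 0) : EuclideanSpace ℝ (Fin 3)) + m ≤
            inner ℝ u (EuclideanSpace.single (0 : Fin 3) (t j) : EuclideanSpace ℝ (Fin 3)))) := by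
  have hin : ∀ c : ℝ, inner ℝ u (EuclideanSpace.single (0 : Fin 3) c : EuclideanSpace ℝ (Fin 3)) =
      c * u 0 := fun c => by rw [EuclideanSpace.inner_single_right]; simp
  simp only [hin]
  rintro (h | h)
  · have ha := h 1 (by decide)
    have hb := h 2 (by decide)
    nlinarith
  · have ha := h 1 (by decide)
    have hb := h 2 (by decide)
    nlinarith

/-- **The strengthening `∃ δ₀ ∀ K` of NS is false**: the mesh threshold cannot be chosen before the
compact set (all other clauses of the crux verbatim). [folklore] -/
theorem nonSeparableModulus_false_uniformMesh :
    ¬ (∃ δ₀ : ℝ, 0 < δ₀ ∧ ∀ (n : ℕ) (K : Set (Fin n → EuclideanSpace ℝ (Fin 3))),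
      K ⊆ NonCoincident 3 n → IsCompact K → ∀ ε : ℝ, 0 < ε →
      ∃ m η : ℝ, 0 < m ∧ 0 < η ∧ ∀ δ ∈ Set.Ioo 0 δ₀, ∀ x ∈ K,
      ∀ (i : Fin n) (y : EuclideanSpace ℝ (Fin 3)), ‖y - x i‖ < η →
      ¬ (∃ u : EuclideanSpace ℝ (Fin 3), (∃ i j : Fin 3, i ≠ j ∧ (u = EuclideanSpace.single i 1 ∨
        u = EuclideanSpace.single i 1 + EuclideanSpace.single j 1 ∨
        u = EuclideanSpace.single i 1 - EuclideanSpace.single j 1)) ∧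
        ((∀ j : Fin n, j ≠ i → inner ℝ u (x j) + m ≤ inner ℝ u (x i)) ∨
         (∀ j : Fin n, j ≠ i → inner ℝ u (x i) + m ≤ inner ℝ u (x j)))) →
      |rescaledCorrelator (criticalCorr 3)
          (fun δ : ℝ => (criticalTwoPoint 3 (Pi.single 0 ⌊δ⁻¹⌋)) ^ (-(1/2:ℝ))) n δ (Function.update x i y) -
        rescaledCorrelator (criticalCorr 3)
          (fun δ : ℝ => (criticalTwoPoint 3 (Pi.single 0 ⌊δ⁻¹⌋)) ^ (-(1/2:ℝ))) n δ x| < ε) := by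
  rintro ⟨δ₀, hδ₀, h⟩
  -- the admissible mesh
  set δ₁ : ℝ := min δ₀ 1 / 2 with hδ₁def
  have hδ₁ : 0 < δ₁ := by positivity
  have hδ₁δ₀ : δ₁ < δ₀ := by
    have := min_le_left δ₀ 1; rw [hδ₁def]; linarith
  -- the family and the compact set
  set cfg : ℝ → Fin 4 → EuclideanSpace ℝ (Fin 3) := fun s i =>
    EuclideanSpace.single (0 : Fin 3) ((![δ₁ - s, δ₁ / 4, 3 * δ₁ / 2, 7 * δ₁ / 4] : Fin 4 → ℝ) i)
    with hcfg
  have hcont : Continuous cfg := by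
    refine continuous_pi fun i => ?_
    have hc : Continuous fun s : ℝ => ((![δ₁ - s, δ₁ / 4, 3 * δ₁ / 2, 7 * δ₁ / 4] : Fin 4 → ℝ) i) := by
      fin_cases i <;> simp <;> fun_prop
    have hrepr : (fun s : ℝ => cfg s i) = fun s =>
        ((![δ₁ - s, δ₁ / 4, 3 * δ₁ / 2, 7 * δ₁ / 4] : Fin 4 → ℝ) i) •
          (EuclideanSpace.single (0 : Fin 3) (1 : ℝ) : EuclideanSpace ℝ (Fin 3)) := by
      funext s
      simp only [hcfg]
      ext j
      simp [PiLp.single_apply]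
    rw [hrepr]
    exact hc.smul continuous_const
  set K : Set (Fin 4 → EuclideanSpace ℝ (Fin 3)) := cfg '' Set.Icc 0 (δ₁ / 2) with hKdef
  have hKc : IsCompact K := isCompact_Icc.image hcont
  have hKs : K ⊆ NonCoincident 3 4 := by
    rintro _ ⟨s, ⟨hs0, hs⟩, rfl⟩
    refine injective_axial fun i j hij => ?_
    fin_cases i <;> fin_cases j <;>
      first | rfl | (exfalso; simp at hij; linarith)
  -- the jump and the data handed back
  set J : ℝ := ((criticalTwoPoint 3 (Pi.single 0 ⌊δ₁⁻¹⌋)) ^ (-(1/2:ℝ))) ^ 4 *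
    (1 - criticalTwoPoint 3 (Pi.single 0 1)) with hJ
  have hρ : 0 < (criticalTwoPoint 3 (Pi.single 0 ⌊δ₁⁻¹⌋)) ^ (-(1/2:ℝ)) :=
    Real.rpow_pos_of_pos (PinnedClusterPoints.criticalTwoPoint_pos3 _) _
  have hJpos : 0 < J := mul_pos (pow_pos hρ 4) (by linarith [criticalTwoPoint_e0_lt_one])
  obtain ⟨m, η, hm, hη, hcl⟩ := h 4 K hKs hKc J hJpos
  -- the witness pair
  set s : ℝ := min (δ₁ / 2) (η / 2) with hsdef
  have hs0 : 0 < s := by positivity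
  have hs : s ≤ δ₁ / 2 := min_le_left _ _
  have hsη : s ≤ η / 2 := min_le_right _ _
  have hxK : cfg s ∈ K := ⟨s, ⟨hs0.le, hs⟩, rfl⟩
  have hyx : ‖(EuclideanSpace.single (0 : Fin 3) δ₁ : EuclideanSpace ℝ (Fin 3)) - cfg s 0‖ < η := by
    simp only [hcfg, Matrix.cons_val_zero, ← PiLp.single_sub, PiLp.norm_single, Real.norm_eq_abs]
    rw [show δ₁ - (δ₁ - s) = s by ring, abs_of_pos hs0]; linarith
  have hns : ¬ (∃ u : EuclideanSpace ℝ (Fin 3), (∃ i j : Fin 3, i ≠ j ∧ (u = EuclideanSpace.single i 1 ∨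
      u = EuclideanSpace.single i 1 + EuclideanSpace.single j 1 ∨
      u = EuclideanSpace.single i 1 - EuclideanSpace.single j 1)) ∧
      ((∀ j : Fin 4, j ≠ 0 → inner ℝ u (cfg s j) + m ≤ inner ℝ u (cfg s 0)) ∨
        (∀ j : Fin 4, j ≠ 0 → inner ℝ u (cfg s 0) + m ≤ inner ℝ u (cfg s j)))) := by
    rintro ⟨u, -, hu⟩
    refine not_caged_disjunction_axial (t := ![δ₁ - s, δ₁ / 4, 3 * δ₁ / 2, 7 * δ₁ / 4]) ?_ ?_ hm u hu
    · simp; linarith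
    · simp; linarith
  have key := hcl δ₁ ⟨hδ₁, hδ₁δ₀⟩ (cfg s) hxK 0 (EuclideanSpace.single (0 : Fin 3) δ₁) hyx hns
  -- lattice shadows: (0,0,1,1)·e₀ before, (1,0,1,1)·e₀ after
  have hfl0 : ⌊(δ₁ - s) / δ₁⌋ = 0 := by
    rw [Int.floor_eq_iff]; push_cast
    exact ⟨div_nonneg (by linarith) hδ₁.le, by rw [zero_add, div_lt_one hδ₁]; linarith⟩
  have hfl1 : ⌊δ₁ / 4 / δ₁⌋ = 0 := by
    rw [Int.floor_eq_iff]; push_cast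
    exact ⟨by positivity, by rw [zero_add, div_lt_one hδ₁]; linarith⟩
  have hfl2 : ⌊3 * δ₁ / 2 / δ₁⌋ = 1 := by
    rw [Int.floor_eq_iff]; push_cast
    exact ⟨by rw [le_div_iff₀ hδ₁]; linarith, by rw [div_lt_iff₀ hδ₁]; linarith⟩
  have hfl3 : ⌊7 * δ₁ / 4 / δ₁⌋ = 1 := by
    rw [Int.floor_eq_iff]; push_cast
    exact ⟨by rw [le_div_iff₀ hδ₁]; linarith, by rw [div_lt_iff₀ hδ₁]; linarith⟩
  have hflw : ⌊δ₁ / δ₁⌋ = 1 := by rw [div_self hδ₁.ne', Int.floor_one]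
  have hshadow : (fun i => latticeApprox δ₁ (cfg s i)) =
      ![(0 : Site 3), 0, Pi.single 0 1, Pi.single 0 1] := by
    funext i
    fin_cases i
    · show latticeApprox δ₁ (cfg s 0) = 0
      simp only [hcfg, Matrix.cons_val_zero, latticeApprox_single_zero, hfl0, Pi.single_zero]
    · show latticeApprox δ₁ (cfg s 1) = 0
      simp only [hcfg, Matrix.cons_val_one, Matrix.cons_val_zero, latticeApprox_single_zero, hfl1,
        Pi.single_zero]
    · show latticeApprox δ₁ (cfg s 2) = Pi.single 0 1
      simp only [hcfg, Matrix.cons_val, latticeApprox_single_zero, hfl2]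
    · show latticeApprox δ₁ (cfg s 3) = Pi.single 0 1
      simp only [hcfg, Matrix.cons_val, latticeApprox_single_zero, hfl3]
  have hshadow' : (fun i => latticeApprox δ₁
      (Function.update (cfg s) 0 (EuclideanSpace.single (0 : Fin 3) δ₁) i)) =
      ![Pi.single 0 1, (0 : Site 3), Pi.single 0 1, Pi.single 0 1] := by
    funext i
    fin_cases i
    · show latticeApprox δ₁ (Function.update (cfg s) 0 (EuclideanSpace.single (0 : Fin 3) δ₁) 0) =
        Pi.single 0 1
      rw [Function.update_self, latticeApprox_single_zero, hflw]
    · show latticeApprox δ₁ (Function.update (cfg s) 0 (EuclideanSpace.single (0 : Fin 3) δ₁) 1) = 0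
      rw [Function.update_of_ne (by decide)]; exact congr_fun hshadow 1
    · show latticeApprox δ₁ (Function.update (cfg s) 0 (EuclideanSpace.single (0 : Fin 3) δ₁) 2) =
        Pi.single 0 1
      rw [Function.update_of_ne (by decide)]; exact congr_fun hshadow 2
    · show latticeApprox δ₁ (Function.update (cfg s) 0 (EuclideanSpace.single (0 : Fin 3) δ₁) 3) =
        Pi.single 0 1
      rw [Function.update_of_ne (by decide)]; exact congr_fun hshadow 3
  have hFx : rescaledCorrelator (criticalCorr 3)
      (fun δ : ℝ => (criticalTwoPoint 3 (Pi.single 0 ⌊δ⁻¹⌋)) ^ (-(1/2:ℝ))) 4 δ₁ (cfg s) =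
      ((criticalTwoPoint 3 (Pi.single 0 ⌊δ₁⁻¹⌋)) ^ (-(1/2:ℝ))) ^ 4 * 1 := by
    rw [rescaledCorrelator_apply, hshadow, criticalCorr_four_aabb]
  have hFy : rescaledCorrelator (criticalCorr 3)
      (fun δ : ℝ => (criticalTwoPoint 3 (Pi.single 0 ⌊δ⁻¹⌋)) ^ (-(1/2:ℝ))) 4 δ₁
        (Function.update (cfg s) 0 (EuclideanSpace.single (0 : Fin 3) δ₁)) =
      ((criticalTwoPoint 3 (Pi.single 0 ⌊δ₁⁻¹⌋)) ^ (-(1/2:ℝ))) ^ 4 *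
        criticalTwoPoint 3 (Pi.single 0 1) := by
    rw [rescaledCorrelator_apply, hshadow', criticalCorr_four_babb, sub_zero]
  rw [hFx, hFy] at key
  have : ((criticalTwoPoint 3 (Pi.single 0 ⌊δ₁⁻¹⌋)) ^ (-(1/2:ℝ))) ^ 4 * criticalTwoPoint 3 (Pi.single 0 1) -
      ((criticalTwoPoint 3 (Pi.single 0 ⌊δ₁⁻¹⌋)) ^ (-(1/2:ℝ))) ^ 4 * 1 = -J := by rw [hJ]; ring
  rw [this, abs_neg, abs_of_pos hJpos] at key
  exact lt_irrefl _ key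

end Summit.CriticalPhenomena.Ising3DConformalLimit.NonSeparableModulusNegative

end
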